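import Summits.HubbardSuperconductivity.HubbardLadder.Bounds.PairSourceWindowRows
import HarnessLib

/-!
# Hubbard ladder — route #2 edge RE-KEYED to the SHAPE of a torus-family upper node (any per-site constant `e`)

HONEST FRAMING (cell pub-hubbard, page 1): ladder R1–R4 with certified numbers; no claim on `H`/`H₀`.
Nothing is instantiated or claimed here; every statement below is a PROVED implication. Result line (iii)
of rung R3 is untouched: no R3 instance has been run; no dichotomy is certified at any size; there are no
brackets to overlap. No pair-sourced window certificate exists (2026-08-20).

`Bounds/PairSourceWindowRows.lean` (#150) proves the route-#2 edge
`pairSourceWindowCertCeilingU8Eighth_holds` keyed to ONE input-(a) node, `luctiUpper_16k_U8_N224kk_ti4ds`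
(`e_up = −369071688991/2³⁹`). The slack `s = e_up − μ·(7/8) − q` enters the booked ceiling `s²/(2h²)`
quadratically and the input-(a) gap is its largest known piece (`e_up = −0.67134` vs the printed `≈ −0.7665`
at `(U, t′, n̄) = (8, 0, 7/8)`), so any better torus-family upper node of the same `16k` shape should be
usable WITHOUT another bridge file. This file provides exactly that:

* the SHAPE of such a node is the explicit hypothesis `ha : ∀ k ≥ 1, E_{16k×16k}(t=1, U=8; N=224k²) ≤ (16k)²·e`
  of every theorem below (no named predicate: an untagged Prop-valued `def` would read as a vendored fact);
  `luctiUpper_16k_U8_N224kk_ti4ds` is literally the instance `e = −369071688991/2³⁹`, so a proof of that node IS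
  such an `ha` by unfolding (see `pairSourceWindowCertCeilingU8Eighth_of_family`).
* `minEnergyOn_szSector_le_of_torusFamilyUpper16` — shape ⇒ the `(N = electronNumber (1/8) L, S^z = 0)` sector
  minimum of `hubbardTorus 2 L 1 8` is `≤ e·L²` on every side `16 ∣ L` (square torus = rectangular torus,
  `groundEnergyAt_fermionTorusGraph_two`; `E₀(2n) = λ_min(n,n)`, `groundEnergyAt_eq_minEnergyOn_szSector`, Lieb 1989).
* `exists_pairSourceEnergyCertAlong_of_torusFamilyUpper16` — shape ∧ the sourced lower-bound row
  `∃ L₀, ∀ L ≥ L₀, eL·L² ≤ E₀(dWaveSourceTorus L 8 μ h)` ∧ `0 < e − μ·(7/8) − eL` ⇒ a `PairSourceEnergyCertAlong`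
  with ceiling `(e − μ·(7/8) − eL)²/(2h²)` (`PairSourceEnergyCertAlong.ofEnergyRows`, #133).
* `liminf_dWaveOrderParamSq_le_of_torusFamilyUpper16_window` — THE GENERIC EDGE: shape (any `e`) ∧
  `Nonempty (DWaveSourceWindowCert 8 μ h q)` ∧ `0 < h` ∧ `0 < e − μ·(7/8) − q` ⇒ along every admissible sequence of
  normalised `S^z = 0` sector ground states of the PURE model at `U = 8`, `N_L = 2⌊(7/8)L²/2⌋`:
  `liminf_k σ_d²(k) ≤ (e − μ·(7/8) − q)²/(2h²)`.
* `pairSourceWindowCertCeilingU8Eighth_of_family` — consistency: #150's keyed obligation is the instance.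

A leaf for a delivered certificate (R3 seat's `code/sourcerows/` generator) may therefore name ANY input-(a)
node `X : Prop` whose statement is this shape for some constant `e` and write its edge as
`liminf_dWaveOrderParamSq_le_of_torusFamilyUpper16_window (e := e) ha hh hs hw N ψ hNψ` with `ha : X`
(the node unfolds to the hypothesis).
Other periods (`d = 4m`, `N = 14m²k²`) would need the same three lemmas with `16 ↦ d`
(`PairSourceEnergyCertAlong.ofEnergyRows` already takes `d` with `4 ∣ d`); not done — every `n̄ = 7/8`
torus-family node in the tree is a `16k` family.

Sources: T. Koma, H. Tasaki, J. Stat. Phys. 76 (1994) 745, Thm 2.2; E. H. Lieb, PRL 62 (1989) 1201, proof of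
Thm 1; X. Han, arXiv:2006.06002 (2020) §3.
-/

noncomputable section

namespace Summit.HubbardSuperconductivity.HubbardLadder.Bounds

open Matrix Filter Literature.Probability.LatticeModels
open Literature.MathematicalPhysics.QuantumLattice
open Summit.HubbardSuperconductivity.HubbardLadder
open scoped ComplexOrder Topology

/-- **Shape ⇒ `hup`.** A torus-family upper node `∀ k ≥ 1, E_{16k×16k}(224k²) ≤ (16k)²·e` bounds the
`(N = electronNumber (1/8) L, S^z = 0)` sector minimum of `hubbardTorus 2 L 1 8` by `e·L²` on every side
`L ≠ 0` with `16 ∣ L` (square torus = `L × L` rectangular torus, `groundEnergyAt_fermionTorusGraph_two`;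
`E₀(2n) = λ_min(n, n)`, `groundEnergyAt_eq_minEnergyOn_szSector`). Verbatim the #149 proof with the
constant a variable. [cite: LiebPRL1989, proof of Theorem 1] -/
theorem minEnergyOn_szSector_le_of_torusFamilyUpper16 {e : ℝ} (ha : ∀ k : ℕ, 1 ≤ k →
      groundEnergyAt (fermionRectTorusGraph (16 * k) (16 * k)) 1 8 (224 * k ^ 2) ≤ ((16 * k : ℕ) : ℝ) ^ 2 * e)
    (L : ℕ) [NeZero L] (hd : 16 ∣ L) :
    (hubbardTorus 2 L 1 8).minEnergyOn (szSector (electronNumber (1 / 8) L) 0) ≤ e * (L : ℝ) ^ 2 := by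
  obtain ⟨k, rfl⟩ := hd
  have hk : 1 ≤ k := Nat.one_le_iff_ne_zero.2 fun h0 => NeZero.ne (16 * k) (by simp [h0])
  have h1 := ha k hk
  have h224 : 224 * k ^ 2 = 2 * (112 * k ^ 2) := by ring
  have hn : 112 * k ^ 2 ≤ Fintype.card (FermionTorus 2 (16 * k)) := by
    have hc : Fintype.card (FermionTorus 2 (16 * k)) = (16 * k) ^ 2 := by
      simp [FermionTorus, Fintype.card_lex]
    rw [hc]; nlinarith [hk]
  rw [← groundEnergyAt_fermionTorusGraph_two, h224,
    groundEnergyAt_eq_minEnergyOn_szSector (fermionTorusGraph 2 (16 * k)) 1 8 hn] at h1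
  rw [electronNumber_eighth_sixteen_mul, hubbardTorus]
  exact h1.trans_eq (mul_comm _ _)

/-- **Shape ∧ sourced lower row ⇒ a sourced-energy certificate along `16 ∣ L`** with ceiling
`(e − μ·(7/8) − eL)²/(2h²)` (`PairSourceEnergyCertAlong.ofEnergyRows`). Input (b) is the HYPOTHESIS
`hb` (no instance known or claimed). [cite: KomaTasaki1994, Theorem 2.2] -/
theorem exists_pairSourceEnergyCertAlong_of_torusFamilyUpper16 {e : ℝ} (ha : ∀ k : ℕ, 1 ≤ k →
      groundEnergyAt (fermionRectTorusGraph (16 * k) (16 * k)) 1 8 (224 * k ^ 2) ≤ ((16 * k : ℕ) : ℝ) ^ 2 * e)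
    {μ h eL : ℝ} (hh : 0 < h) (hs : 0 < e - μ * (7 / 8) - eL)
    (hb : ∃ L₀ : ℕ, ∀ (L : ℕ) [NeZero L], L₀ ≤ L → eL * (L : ℝ) ^ 2 ≤ (dWaveSourceTorus L 8 μ h).groundEnergy) :
    ∃ c : PairSourceEnergyCertAlong 8 (electronNumber (1 / 8)) 16,
      c.ceiling = (e - μ * (7 / 8) - eL) ^ 2 / (2 * h ^ 2) := by
  obtain ⟨L₁, hL₁⟩ := hb
  exact ⟨PairSourceEnergyCertAlong.ofEnergyRows (U := 8) (N := electronNumber (1 / 8)) (d := 16) h hh μ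
      e eL (7 / 8) L₁ hs
      (fun L _ hdL => electronNumber_eighth_of_four_dvd (dvd_trans ⟨4, by norm_num⟩ hdL))
      (fun L _ _ hdL => minEnergyOn_szSector_le_of_torusFamilyUpper16 ha L hdL)
      (fun L _ hL _ => hL₁ L hL), rfl⟩

/-- **THE GENERIC ROUTE-#2 EDGE (PROVED).** Any torus-family upper node
`∀ k ≥ 1, E_{16k×16k}(224k²) ≤ (16k)²·e` (input (a)) AND any pair-sourced translation-invariant window certificate
`DWaveSourceWindowCert 8 μ h q` (input (b); none exists today) with `0 < h` and positive slack
`s = e − μ·(7/8) − q` imply, along every admissible sequence of normalised `S^z = 0` sector ground states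
of the PURE Hubbard model at `t = 1`, `t′ = 0`, `U = 8`, `N_L = 2⌊(7/8)L²/2⌋`: `liminf_k σ_d²(k) ≤ s²/(2h²)`.
New as a statement only when `s²/(2h²) < 128/π⁴` (`limsup_dWaveOrderParamSq_le_kinematic`).
HONEST FRAMING: ladder R1–R4 with certified numbers; no claim on `H`/`H₀`; nothing instantiated.
[cite: KomaTasaki1994, Theorem 2.2] -/
theorem liminf_dWaveOrderParamSq_le_of_torusFamilyUpper16_window {e μ h q : ℝ}
    (ha : ∀ k : ℕ, 1 ≤ k →
      groundEnergyAt (fermionRectTorusGraph (16 * k) (16 * k)) 1 8 (224 * k ^ 2) ≤ ((16 * k : ℕ) : ℝ) ^ 2 * e) (hh : 0 < h) (hs : 0 < e - μ * (7 / 8) - q)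
    (hw : Nonempty (DWaveSourceWindowCert 8 μ h q))
    (N : ℕ → ℕ) (ψ : ∀ L, Fock (Orb (FermionTorus 2 L)))
    (hNψ : ∀ L, Even L → N L = 2 * ⌊(1 - 1 / 8) * (L : ℝ) ^ 2 / 2⌋₊ ∧ star (ψ L) ⬝ᵥ ψ L = 1 ∧
        IsGroundStateInSector (hubbardTorus 2 L 1 8) (N L) 0 (ψ L)) :
    liminf (fun k => dWaveOrderParamSq ψ k) atTop ≤ (e - μ * (7 / 8) - q) ^ 2 / (2 * h ^ 2) := by
  obtain ⟨C⟩ := hw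
  obtain ⟨c, hc⟩ :=
    exists_pairSourceEnergyCertAlong_of_torusFamilyUpper16 ha hh hs C.groundEnergy_ge_eventually
  rw [← hc]
  exact liminf_dWaveOrderParamSq_le_of_pairSourceEnergyCertAlong (d := 16) (by norm_num) ⟨8, by norm_num⟩
    c N ψ hNψ

/-- Consistency (kernel): the keyed obligation `PairSourceWindowCertCeilingU8Eighth` of #150 is the
`e = −369071688991/2³⁹` instance of the generic edge — the node's proof `ha` is passed AS the shape hypothesis
(definitional unfolding), which is exactly how a leaf uses any other node of this shape. -/
theorem pairSourceWindowCertCeilingU8Eighth_of_family : PairSourceWindowCertCeilingU8Eighth :=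
  fun ha _μ _h _q hh hs hw N ψ hNψ =>
    liminf_dWaveOrderParamSq_le_of_torusFamilyUpper16_window (e := (-369071688991 : ℝ) / 2 ^ 39) ha hh hs hw N ψ hNψ

end Summit.HubbardSuperconductivity.HubbardLadder.Bounds

end
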